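import Summits.KontsevichZagierPeriods.KontsevichZagierPeriods.Theorems.SoloInformedAlgebraicParameterTransfer
import Summits.KontsevichZagierPeriods.KontsevichZagierPeriods.Theorems.SoloInformedAlgebraicCoefficientDescent
import Summits.KontsevichZagierPeriods.KontsevichZagierPeriods.Theorems.SoloInformedRealParameterPinning
import HarnessLib

/-!
# SoloInformed — the real-algebraic core of THEOREM T (`KZ_ℝ` is conservative over `ℚ`-data)

Solo programme `solo-KontsevichZagierPeriods-informed`, session s137, file 4: the three s137 files
assembled into the two statements the programme's `KZ_ℝ` METHOD BARRIER actually invokes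
(paper `real-parameters.md`; VERDICT §4), so that everything in THEOREMS R / T and COROLLARY SQ
except the first-order-ness of "these real parameters form a valid fixed-shape chain" is KERNEL:

* `soloInformed_realParameter_transfer_core` — **THEOREM T's core.** If the validity condition
  `Valid` on a real parameter vector `c ∈ ℝᵐ` is `ℚ`-semialgebraic and has a solution, then it has
  a solution `c₁` with algebraic coordinates, and at `c₁` EVERY `ℚ`-semialgebraic family
  `S ⊆ ℝ^{m ⊕ n}` (in every dimension `n`) has a `ℚ`-semialgebraic fibre `S(c₁)`: the
  re-instantiated data are literally `ℚ`-semialgebraic (files 1 and 2).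
* `soloInformed_realSemialgebraic_algebraic_presentation` — an `ℝ`-semialgebraic set presented by a
  `ℚ`-semialgebraic family at an ALGEBRAIC parameter is `ℚ`-semialgebraic, and every
  `ℝ`-semialgebraic set is presented by some `ℚ`-semialgebraic family at some real parameter
  (files 1 and 2) — the dictionary "`ℝ`-semialgebraic = `ℚ`-semialgebraic family + real vector;
  algebraic vector ⇒ `ℚ`-semialgebraic".
* `soloInformed_realParameter_barrier_core` — **THEOREM R's / COR SQ's core.** A `ℚ`-semialgebraic
  validity condition all of whose solutions give a fixed transcendental value to some rational
  polynomial of the parameters has no solution (file 3), contraposed with the transfer: if it has a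
  solution, the pinned value is algebraic.

References: paper `real-parameters.md`; Basu–Pollack–Roy (2006) Thm. 2.77–2.80; Bochnak–Coste–Roy
(1998) §5.1–5.2.
-/

noncomputable section

namespace Summit.KontsevichZagierPeriods.KontsevichZagierPeriods.Theorems

open Set Literature.ModelTheory.ExponentialFields Literature.NumberTheory.Transcendental

/-- **THEOREM T, real-algebraic core.** A solvable `ℚ`-semialgebraic condition on real parameters
has an algebraic solution `c₁`, and at `c₁` every `ℚ`-semialgebraic family has `ℚ`-semialgebraic
fibres (`soloInformed_realParameter_transfer` +
`soloInformed_isSemialgebraic_rat_fibre_of_isAlgebraic`).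
[cite: BasuPollackRoy2006, Thm. 2.80 and Cor. 2.78] -/
theorem soloInformed_realParameter_transfer_core {m : ℕ} {Valid : (Fin m → ℝ) → Prop}
    (hV : IsSemialgebraic ℚ {c | Valid c}) {c₀ : Fin m → ℝ} (h₀ : Valid c₀) :
    ∃ c₁ : Fin m → ℝ, Valid c₁ ∧ (∀ j, IsAlgebraic ℚ (c₁ j)) ∧
      ∀ (n : ℕ) (S : Set (Fin m ⊕ Fin n → ℝ)), IsSemialgebraic ℚ S →
        IsSemialgebraic ℚ {x : Fin n → ℝ | Sum.elim c₁ x ∈ S} := by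
  obtain ⟨c₁, hc₁, halg⟩ := soloInformed_realParameter_transfer hV h₀
  exact ⟨c₁, hc₁, halg, fun n S hS => soloInformed_isSemialgebraic_rat_fibre_of_isAlgebraic hS halg⟩

/-- **The dictionary.** (1) Every `ℝ`-semialgebraic `s ⊆ ℝⁿ` is the fibre of a `ℚ`-semialgebraic
family at a real parameter vector; (2) a fibre of a `ℚ`-semialgebraic family at an ALGEBRAIC
parameter vector is `ℚ`-semialgebraic (so `ℝ_alg`-presented data are `ℚ`-data).
[cite: BasuPollackRoy2006, Cor. 2.78] -/
theorem soloInformed_realSemialgebraic_algebraic_presentation {n : ℕ} :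
    (∀ s : Set (Fin n → ℝ), IsSemialgebraic ℝ s →
      ∃ (m : ℕ) (c : Fin m → ℝ) (S : Set (Fin m ⊕ Fin n → ℝ)),
        IsSemialgebraic ℚ S ∧ s = {x | Sum.elim c x ∈ S}) ∧
    (∀ (m : ℕ) (c : Fin m → ℝ) (S : Set (Fin m ⊕ Fin n → ℝ)), IsSemialgebraic ℚ S →
      (∀ j, IsAlgebraic ℚ (c j)) → IsSemialgebraic ℚ {x : Fin n → ℝ | Sum.elim c x ∈ S}) :=
  ⟨fun _ hs => soloInformed_isSemialgebraic_real_iff_fibre.1 hs,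
    fun _ _ _ hS hc => soloInformed_isSemialgebraic_rat_fibre_of_isAlgebraic hS hc⟩

/-- **THEOREM R / COROLLARY SQ, real-algebraic core, both readings.** For a `ℚ`-semialgebraic
validity condition whose solutions all give the value `τ` to a rational polynomial `value` of the
parameters: if `τ` is transcendental there is no solution; equivalently, a solution forces `τ` to be
algebraic (`τ = log 2` in THEOREM R, `τ = π = s²` in COR SQ).
[cite: BochnakCosteRoy1998, §5.2] -/
theorem soloInformed_realParameter_barrier_core {k : ℕ} {Valid : (Fin k → ℝ) → Prop}
    (hV : IsSemialgebraic ℚ {p | Valid p}) (value : MvPolynomial (Fin k) ℚ) {τ : ℝ}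
    (hsound : ∀ p, Valid p → MvPolynomial.aeval p value = τ) :
    (Transcendental ℚ τ → ∀ p, ¬ Valid p) ∧ ((∃ p, Valid p) → IsAlgebraic ℚ τ) := by
  refine ⟨fun hτ => soloInformed_no_valid_parameter_of_value_transcendental hV value hτ hsound,
    fun ⟨p, hp⟩ => ?_⟩
  obtain ⟨c₁, hc₁, halg⟩ := soloInformed_realParameter_transfer hV hp
  rw [← hsound c₁ hc₁]
  exact soloInformed_isAlgebraic_aeval_of_forall_isAlgebraic halg value

end Summit.KontsevichZagierPeriods.KontsevichZagierPeriods.Theorems
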